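import Mathlib
import Summits.Ventures.HodgeRepro.Tier4.Line4.HorbMain
import Summits.Ventures.HodgeRepro.Tier4.Line4.TailBoundL1

/-!
# Tier4/Line4/NormFactor — the `L¹`-norm of a product test function along one double coset FACTORS through the chain:
the trivial-character orbital of `‖F‖`

Blind re-derivation cell `pub-hodge-repro`, Tier 4 «prove the step» (README §9–§10), seat t4-L4-p2 (prover, LINE L4,
gen 4; cut C-L4-NORMFACTOR, plan-4 g5 S15184 (4), statement S15193).  Tree path
`lean/Summits/Ventures/HodgeRepro/Tier4/Line4/NormFactor.lean`.  One `def` (the RTF data with trivial characters); no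
literature.

TailBoundL1 bounds the tail of the geometric side by `∑_{γ ∉ E} ∫_{D_T}∫_{D_{T′}} ‖F(t⁻¹ γ t')‖` — the `L¹`-norms of the test
function along the twisted orbits.  Summed over ONE double coset `o = orbitOf γ`, that quantity is the orbital term of the
TRIVIAL-CHARACTER data `R₁ := R.trivialChars` applied to the complexified norm `‖F‖` (`orbital_one_eq_tsum_integral_norm`,
on the generic setting: the partial kernel of `‖F‖` is the fibre sum of norms, `Complex.ofReal_tsum`, and the two
interchanges of TailBoundL1).  L2-p1's chain (`orbital_eq_mul_of_chain`, HorbMain) then FACTORS it for a product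
`F = Finf ⊗ Ffin` at a regular rational `γ`:
  `∑'_{γ' ∈ o} ∫_{D_T}∫_{D_{T′}} ‖F(t⁻¹ γ' t')‖ = (c c') · (∫_{T_∞} I_∞) · (∫_{D_{Z_f}} I_f)`,
`I_∞(a) = ∫_{T′_∞} ‖Finf(a⁻¹ γ_∞ a')‖`, `I_f(b) = ∫_{T′_f} ‖Ffin(b⁻¹ γ_f b')‖` — the archimedean `L¹`-norm along `γ_∞` (the decay)
times the FINITE-PART level measure of `γ` (for the indicator witness, `levelNorm⁻¹ · suppMeasure N γ`).  The chain's
(A1)–(A4) and the orbit-sum summability are DISCHARGED here from TailBoundL1 for any continuous `F` with the uniform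
Poincaré bound; its (B1)–(B4) and the PRODINT integrability clauses (integrals over the FULL tori and the product domain)
stay binders, exactly as for `γ₀` in the chain.

Nothing here says anything about the status of the Hodge conjecture for CM abelian varieties, which is NOT proved
(HC_CM is NOT proved by anyone in this repository).
-/

set_option autoImplicit false

noncomputable section

namespace Summit.Ventures.HodgeRepro.Tier4.Line4

open MeasureTheory Topology Filter Set NumberField Summit.Ventures.HodgeRepro.Tier4
  Summit.Ventures.HodgeRepro.Tier4.Common Summit.Ventures.HodgeRepro.Tier4.Line1
  Summit.Ventures.HodgeRepro.Tier4.Line1.RTF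

open scoped ComplexConjugate NNReal

/-! ## 1. The bridge on the generic setting: the trivial-character orbital of the norm -/

section Bridge

variable {G : Type} [Group G] [TopologicalSpace G] [IsTopologicalGroup G] [MeasurableSpace G] [BorelSpace G]
  (S : Setting G) [SecondCountableTopology G]

/-- **The trivial-character orbital of the norm is the fibre sum of the `L¹`-norms along the orbits**:
`S.orbital 1 1 o ‖f‖ = ∑'_{γ ∈ o} ∫_{D_T}∫_{D_{T′}} ‖f(t⁻¹ γ t')‖` (as a real number, complexified). -/
theorem orbital_one_eq_tsum_integral_norm {f : G → ℂ} (hf : Continuous f) (hP : L1Class.PoincareSummable S f)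
    (o : S.Orbit) :
    S.orbital (fun _ => (1 : ℂ)) (fun _ => (1 : ℂ)) o (fun x => ((‖f x‖ : ℝ) : ℂ)) =
      ((∑' γ : {γ : S.Gk // S.orbitOf γ = o},
        ∫ t in S.DT, ∫ t' in S.DT', ‖f ((t : G)⁻¹ * γ.1 * t')‖ ∂S.μT' ∂S.μT : ℝ) : ℂ) := by
  haveI : Countable S.Gk := countable_Gk S
  have hs := summable_norm_of_poincareUniform S hP
  obtain ⟨M, hM⟩ := exists_bound_tsum_norm_closure S hP
  set A : Set S.Gk := {γ | S.orbitOf γ = o} with hA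
  -- the partial kernel of the complexified norm is the complexified fibre sum of norms
  have hpk : ∀ t : S.T, ∀ t' : S.T', S.partialKernel o (fun x => ((‖f x‖ : ℝ) : ℂ)) t t' =
      ((∑' γ : A, ‖f ((t : G)⁻¹ * γ.1 * t')‖ : ℝ) : ℂ) := by
    intro t t'
    unfold Setting.partialKernel
    rw [Complex.ofReal_tsum]
    rfl
  -- the inner integral, for `t ∈ closure D_T`
  have hinner : ∀ t ∈ closure S.DT,
      ∫ t' in S.DT', S.partialKernel o (fun x => ((‖f x‖ : ℝ) : ℂ)) t t' * (1 : ℂ) * starRingEnd ℂ (1 : ℂ) ∂S.μT' =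
        ((∑' γ : A, ∫ t' in S.DT', ‖f ((t : G)⁻¹ * γ.1 * t')‖ ∂S.μT' : ℝ) : ℂ) := by
    intro t ht
    simp only [hpk, mul_one, map_one]
    rw [integral_complex_ofReal, integral_tsum_norm_subtype_DT' S hf hM hs A ht]
  unfold Setting.orbital
  show (∫ t in S.DT, ∫ t' in S.DT',
      S.partialKernel o (fun x => ((‖f x‖ : ℝ) : ℂ)) t t' * (1 : ℂ) * starRingEnd ℂ (1 : ℂ) ∂S.μT' ∂S.μT) =
    ((∑' γ : A, ∫ t in S.DT, ∫ t' in S.DT', ‖f ((t : G)⁻¹ * γ.1 * t')‖ ∂S.μT' ∂S.μT : ℝ) : ℂ)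
  rw [← integral_tsum_integral_norm_subtype_DT S hf hM hs A, ← integral_complex_ofReal]
  apply RTF.Geometric.setIntegral_congr_of_eqOn_closure
  intro t ht
  exact hinner t ht

end Bridge

/-! ## 2. The RTF data with trivial characters -/

section Trivial

variable {k : Type} [Field k] [NumberField k] (W : PlaneData k) [MeasurableSpace (GA W)]

/-- **The RTF data with TRIVIAL characters**: the same tori, measures and fundamental domains, `χ = χ′ = 1`. -/
def RTFData.trivialChars (R : RTFData W) : RTFData W where
  chi := fun _ => 1
  chi' := fun _ => 1
  chi_mul := fun _ _ => (one_mul (1 : ℂ)).symm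
  chi'_mul := fun _ _ => (one_mul (1 : ℂ)).symm
  chi_rational := fun _ _ => rfl
  chi'_rational := fun _ _ => rfl
  chi_centre := fun _ _ => rfl
  μT := R.μT
  μT' := R.μT'
  DT := R.DT
  DT' := R.DT'
  DT_fund := R.DT_fund
  DT'_fund := R.DT'_fund

/-- The trivial-character data is Haar when the original is (the measures and domains are the same). -/
theorem RTFData.isHaar_trivialChars {R : RTFData W} (hR : R.IsHaar) : (RTFData.trivialChars W R).IsHaar := hR

end Trivial

/-! ## 3. The chain's (A1)–(A4) and the orbit-sum summability for the norm of a continuous `F` with the Poincaré bound -/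

section Discharge

variable {k : Type} [Field k] [NumberField k] (W : PlaneData k) [MeasurableSpace (GA W)] [BorelSpace (GA W)]
  (R : RTFData W) (μ : Measure (GA W)) [μ.IsHaarMeasure] [R.μT.IsHaarMeasure] [R.μT'.IsHaarMeasure]
  (DG : Set (GA W)) (fdG : IsFundamentalDomain (rationalPoints W) DG μ) (compG : IsCompact (closure DG))
  (compT : IsCompact (closure R.DT)) (compT' : IsCompact (closure R.DT'))

omit [BorelSpace (GA W)] [μ.IsHaarMeasure] [R.μT.IsHaarMeasure] [R.μT'.IsHaarMeasure] in
/-- The inner integrand of the trivial-character data at the complexified norm is the complexified norm along the orbit. -/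
theorem innerFn_trivialChars_norm (F : GA W → ℂ) (γ : GA W) (t : torusT W) :
    innerFn W (RTFData.trivialChars W R) (fun x => ((‖F x‖ : ℝ) : ℂ)) γ t =
      fun t' : torusT' W => ((‖F ((t : GA W)⁻¹ * γ * (t' : GA W))‖ : ℝ) : ℂ) := by
  funext t'
  simp [innerFn, RTFData.chi'conj, RTFData.trivialChars]

omit [BorelSpace (GA W)] [μ.IsHaarMeasure] [R.μT.IsHaarMeasure] [R.μT'.IsHaarMeasure] in
/-- The inner integral of the trivial-character data at the complexified norm is the complexified inner `L¹`-norm. -/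
theorem innerInt_trivialChars_norm (F : GA W → ℂ) (γ : GA W) (t : torusT W) :
    innerInt W (RTFData.trivialChars W R) (fun x => ((‖F x‖ : ℝ) : ℂ)) γ t =
      ((∫ t' in R.DT', ‖F ((t : GA W)⁻¹ * γ * (t' : GA W))‖ ∂(R.μT') : ℝ) : ℂ) := by
  unfold innerInt
  rw [innerFn_trivialChars_norm]
  exact integral_complex_ofReal

/-- Summability of the inner `L¹`-norms at ANY `t` (the Poincaré bound at the singleton `{t}`). -/
theorem summable_integral_norm_orbit_DT'_of_poincare {F : GA W → ℂ} (hFc : Continuous F)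
    (hP : L1Class.PoincareSummable (Setting.ofAdelicData W R μ DG fdG compG compT compT') F) (t : torusT W) :
    Summable (fun γ : rationalPoints W => ∫ t' in R.DT', ‖F ((t : GA W)⁻¹ * γ * (t' : GA W))‖ ∂(R.μT')) := by
  set S := Setting.ofAdelicData W R μ DG fdG compG compT compT' with hS
  have hs := summable_norm_of_poincareUniform S hP
  obtain ⟨M, hM⟩ := hP {(t : GA W)} ((fun t' : S.T' => (t' : GA W)) '' closure S.DT') isCompact_singleton
    (S.compT'.image continuous_subtype_val)
  refine summable_of_sum_le (fun γ => integral_nonneg fun _ => norm_nonneg _) (c := M * S.μT'.real S.DT')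
    fun s => ?_
  have hint : ∀ γ : rationalPoints W,
      IntegrableOn (fun t' : torusT' W => ‖F ((t : GA W)⁻¹ * γ * (t' : GA W))‖) R.DT' R.μT' :=
    fun γ => integrableOn_norm_orbit_DT' S hFc γ t
  rw [← integral_finsetSum _ fun γ _ => hint γ]
  refine (Real.le_norm_self _).trans (norm_setIntegral_le_of_norm_le_const (measure_DT'_lt_top S)
    fun t' ht' => ?_)
  rw [Real.norm_of_nonneg (Finset.sum_nonneg fun γ _ => norm_nonneg _)]
  exact (Summable.sum_le_tsum (f := fun γ : S.Gk => ‖F ((t : GA W)⁻¹ * γ * (t' : GA W))‖) s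
    (fun γ _ => norm_nonneg _) (hs t t')).trans (hM _ (Set.mem_singleton _) _ ⟨t', subset_closure ht', rfl⟩).2

end Discharge

/-! ## 4. The factorisation -/

section Factor

variable {k : Type} [Field k] [NumberField k] (W : PlaneData k) [MeasurableSpace (GA W)] [BorelSpace (GA W)]
  (R : RTFData W) (μ : Measure (GA W)) [μ.IsHaarMeasure] [R.μT.IsHaarMeasure] [R.μT'.IsHaarMeasure]
  (DG : Set (GA W)) (fdG : IsFundamentalDomain (rationalPoints W) DG μ) (compG : IsCompact (closure DG))
  (compT : IsCompact (closure R.DT)) (compT' : IsCompact (closure R.DT'))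

/-- **THE `L¹`-NORM ALONG ONE DOUBLE COSET FACTORS** (the chain at the trivial-character data): for a product
`F = Finf ⊗ Ffin` (continuous, with the uniform Poincaré bound) and a regular rational `γ`, with product Haar
normalisations of the two toric measures and a fundamental domain `DZ_f` of the image of `Z(k)` in `T_f`,
`∑'_{γ' ∈ orbitOf γ} ∫_{D_T}∫_{D_{T′}} ‖F(t⁻¹ γ' t')‖ = (c c') · (∫_{T_∞} I_∞) · (∫_{D_{Z_f}} I_f)` with
`I_∞ = innerInf` / `I_f = innerFin` of the trivial-character data at the complexified norms `‖Finf‖`, `‖Ffin‖`.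
The chain's (B1)–(B4) and PRODINT clauses at the trivial-character data are binders, as for `γ₀` in `orbital_eq_mul_of_chain`;
its (A1)–(A4) and the orbit-sum summability are discharged from TailBoundL1. -/
theorem tsum_integral_norm_orbit_eq_mul_of_chain [MeasurableMul (torusT W)] [MeasurableMul (torusT' W)]
    (hR : R.IsHaar) (F Finf Ffin : GA W → ℂ)
    (hF : ∀ g, F g = Finf (GA.ofInfPart W g) * Ffin (GA.ofFinPart W g)) (hFc : Continuous F)
    (hP : L1Class.PoincareSummable (Setting.ofAdelicData W R μ DG fdG compG compT compT') F)
    (γ : rationalPoints W) (hreg : IsRegularRational W γ)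
    (νinf : Measure (torusInf W)) [νinf.IsHaarMeasure] (νf : Measure (torusFin W)) [νf.IsHaarMeasure]
    (c : ℝ≥0) (hc : R.μT = c • Measure.map (torusSplit W).symm (νinf.prod νf))
    (νinf' : Measure (torusInf' W)) [νinf'.IsHaarMeasure] (νf' : Measure (torusFin' W)) [νf'.IsHaarMeasure]
    (c' : ℝ≥0) (hc' : R.μT' = c' • Measure.map (torusSplit' W).symm (νinf'.prod νf'))
    (DZf : Set (torusFin W)) (hDZf : MeasurableSet DZf) (hfd : IsFundamentalDomain (centreFin W) DZf νf)
    -- UNFOLD-Z (B1)–(B4) at the trivial-character data and the complexified norm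
    (hB1 : IntegrableOn (fun t : torusT W => (RTFData.trivialChars W R).chi t *
      innerFull W (RTFData.trivialChars W R) (fun x => ((‖F x‖ : ℝ) : ℂ)) (γ : GA W) t) (prodDomain W DZf) R.μT)
    (hB2 : ∀ s : torusT W, Integrable (innerFn W (RTFData.trivialChars W R) (fun x => ((‖F x‖ : ℝ) : ℂ)) (γ : GA W) s)
      R.μT')
    (hB3 : ∀ (δ : rationalOf W (torusT W)) (δ' : rationalOf W (torusT' W)),
      Integrable (fun t : torusT W => (RTFData.trivialChars W R).chi t *
        innerInt W (RTFData.trivialChars W R) (fun x => ((‖F x‖ : ℝ) : ℂ))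
        (((δ : torusT W) : GA W)⁻¹ * (γ : GA W) * ((δ' : torusT' W) : GA W)) t) (R.μT.restrict R.DT))
    (hB4 : ∀ δ : rationalOf W (torusT W), Summable (fun δ' : rationalOf W (torusT' W) =>
      ∫ t in R.DT, ‖(RTFData.trivialChars W R).chi t *
        innerInt W (RTFData.trivialChars W R) (fun x => ((‖F x‖ : ℝ) : ℂ))
        (((δ : torusT W) : GA W)⁻¹ * (γ : GA W) * ((δ' : torusT' W) : GA W)) t‖ ∂(R.μT)))
    -- PRODINT integrability clauses at the complexified factors
    (hA : ∀ t : torusT W, Integrable (fun a : torusInf' W => conj ((RTFData.trivialChars W R).chi' (a : torusT' W)) *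
      ((‖Finf ((GA.ofInfPart W t)⁻¹ * GA.ofInfPart W (γ : GA W) * ((a : torusT' W) : GA W))‖ : ℝ) : ℂ)) νinf')
    (hB : ∀ t : torusT W, Integrable (fun b : torusFin' W => conj ((RTFData.trivialChars W R).chi' (b : torusT' W)) *
      ((‖Ffin ((GA.ofFinPart W t)⁻¹ * GA.ofFinPart W (γ : GA W) * ((b : torusT' W) : GA W))‖ : ℝ) : ℂ)) νf')
    (hIinf : Integrable (fun a : torusInf W => (RTFData.trivialChars W R).chi a *
      innerInf W (RTFData.trivialChars W R) (fun x => ((‖Finf x‖ : ℝ) : ℂ)) (γ : GA W) νinf' a) νinf)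
    (hIfin : IntegrableOn (fun b : torusFin W => (RTFData.trivialChars W R).chi b *
      innerFin W (RTFData.trivialChars W R) (fun x => ((‖Ffin x‖ : ℝ) : ℂ)) (γ : GA W) νf' b) DZf νf) :
    ((∑' γ' : {γ' : rationalPoints W // (Setting.ofAdelicData W R μ DG fdG compG compT compT').orbitOf γ' =
        (Setting.ofAdelicData W R μ DG fdG compG compT compT').orbitOf γ},
      ∫ t in R.DT, ∫ t' in R.DT', ‖F ((t : GA W)⁻¹ * γ'.1 * (t' : GA W))‖ ∂(R.μT') ∂(R.μT) : ℝ) : ℂ) =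
      ((c : ℂ) * (c' : ℂ)) *
        (∫ a : torusInf W, innerInf W (RTFData.trivialChars W R) (fun x => ((‖Finf x‖ : ℝ) : ℂ)) (γ : GA W) νinf' a ∂νinf) *
        (∫ b in DZf, innerFin W (RTFData.trivialChars W R) (fun x => ((‖Ffin x‖ : ℝ) : ℂ)) (γ : GA W) νf' b ∂νf) := by
  haveI : SecondCountableTopology (GA W) := secondCountable_GA W
  haveI : Countable (rationalPoints W) := rationalPoints_countable W
  set S := Setting.ofAdelicData W R μ DG fdG compG compT compT' with hS
  set R₁ := RTFData.trivialChars W R with hR₁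
  haveI : R₁.μT.IsHaarMeasure := (inferInstance : R.μT.IsHaarMeasure)
  haveI : R₁.μT'.IsHaarMeasure := (inferInstance : R.μT'.IsHaarMeasure)
  set S₁ := Setting.ofAdelicData W R₁ μ DG fdG compG compT compT' with hS₁
  set Fn : GA W → ℂ := fun x => ((‖F x‖ : ℝ) : ℂ) with hFn
  have hP₁ : L1Class.PoincareSummable S₁ F := hP
  -- the complexified norms form a product
  have hFn : ∀ g, Fn g = (fun x => ((‖Finf x‖ : ℝ) : ℂ)) (GA.ofInfPart W g) * (fun x => ((‖Ffin x‖ : ℝ) : ℂ)) (GA.ofFinPart W g) := by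
    intro g
    simp only [Fn, hF g, norm_mul, Complex.ofReal_mul]
  -- (A1): the inner integrands are integrable on `D_{T′}`
  have hA1 : ∀ (γ' : rationalPoints W) (t : torusT W), Integrable (innerFn W R₁ Fn (γ' : GA W) t) (R₁.μT'.restrict R₁.DT') := by
    intro γ' t
    rw [innerFn_trivialChars_norm]
    exact (integrableOn_norm_orbit_DT' S hFc γ' t).ofReal
  -- (A3): the inner integrals are integrable on `D_T`
  have hA3 : ∀ γ' : rationalPoints W, Integrable (fun t : torusT W => R₁.chi t * innerInt W R₁ Fn (γ' : GA W) t)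
      (R₁.μT.restrict R₁.DT) := by
    intro γ'
    have h := (integrableOn_integral_norm_orbit_DT S hFc γ').ofReal (𝕜 := ℂ)
    refine h.congr (Eventually.of_forall fun t => ?_)
    simp only
    rw [innerInt_trivialChars_norm]
    show ((∫ t' in R.DT', ‖F ((t : GA W)⁻¹ * γ' * (t' : GA W))‖ ∂(R.μT') : ℝ) : ℂ) =
      (1 : ℂ) * ((∫ t' in R.DT', ‖F ((t : GA W)⁻¹ * γ' * (t' : GA W))‖ ∂(R.μT') : ℝ) : ℂ)
    rw [one_mul]
  -- (A2): the inner `L¹`-norms are summable over the orbit, at every `t`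
  have hA2 : ∀ t : torusT W, Summable (fun γ' : Set.range (orbitMap W γ) =>
      ∫ t' in R₁.DT', ‖innerFn W R₁ Fn ((γ' : rationalPoints W) : GA W) t t'‖ ∂(R₁.μT')) := by
    intro t
    refine ((summable_integral_norm_orbit_DT'_of_poincare W R μ DG fdG compG compT compT' hFc hP t).subtype
      (Set.range (orbitMap W γ))).congr fun γ' => ?_
    refine integral_congr_ae (Eventually.of_forall fun t' => ?_)
    simp only
    rw [innerFn_trivialChars_norm]
    show ‖F ((t : GA W)⁻¹ * γ' * (t' : GA W))‖ = ‖((‖F ((t : GA W)⁻¹ * γ' * (t' : GA W))‖ : ℝ) : ℂ)‖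
    rw [Complex.norm_real, norm_norm]
  -- (A4): the double `L¹`-norms are summable over the orbit
  have hsumγ := summable_integral_norm_orbit S hFc
    (exists_bound_tsum_norm_closure S hP).choose_spec (summable_norm_of_poincareUniform S hP)
  have hA4 : Summable (fun γ' : Set.range (orbitMap W γ) =>
      ∫ t in R₁.DT, ‖R₁.chi t * innerInt W R₁ Fn ((γ' : rationalPoints W) : GA W) t‖ ∂(R₁.μT)) := by
    refine (hsumγ.subtype (Set.range (orbitMap W γ))).congr fun γ' => ?_
    refine integral_congr_ae (Eventually.of_forall fun t => ?_)
    simp only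
    rw [innerInt_trivialChars_norm]
    show (∫ t' in R.DT', ‖F ((t : GA W)⁻¹ * γ' * (t' : GA W))‖ ∂(R.μT')) =
      ‖(1 : ℂ) * ((∫ t' in R.DT', ‖F ((t : GA W)⁻¹ * γ' * (t' : GA W))‖ ∂(R.μT') : ℝ) : ℂ)‖
    rw [one_mul, Complex.norm_real, Real.norm_of_nonneg (integral_nonneg fun _ => norm_nonneg _)]
  -- the orbit sum of the folded orbital integrals is summable
  have hs : Summable (fun γ' : Set.range (orbitMap W γ) => R₁.orbitalc ((γ' : rationalPoints W) : GA W) Fn) := by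
    refine (Complex.summable_ofReal.mpr (hsumγ.subtype (Set.range (orbitMap W γ)))).congr fun γ' => ?_
    simp only [Function.comp_apply]
    rw [orbitalc_eq_integral W R₁ Fn _ (hA1 γ'.1) (hA3 γ'.1), ← integral_complex_ofReal]
    refine integral_congr_ae (Eventually.of_forall fun t => ?_)
    simp only
    rw [innerInt_trivialChars_norm]
    show ((∫ t' in R.DT', ‖F ((t : GA W)⁻¹ * γ' * (t' : GA W))‖ ∂(R.μT') : ℝ) : ℂ) =
      (1 : ℂ) * ((∫ t' in R.DT', ‖F ((t : GA W)⁻¹ * γ' * (t' : GA W))‖ ∂(R.μT') : ℝ) : ℂ)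
    rw [one_mul]
  -- the chain at the trivial-character data
  have hchain := orbital_eq_mul_of_chain W R₁ μ DG fdG compG compT compT' (RTFData.isHaar_trivialChars W hR) Fn
    (fun x => ((‖Finf x‖ : ℝ) : ℂ)) (fun x => ((‖Ffin x‖ : ℝ) : ℂ)) hFn γ hreg νinf νf c hc νinf' νf' c' hc' DZf hDZf hfd
    hA1 hA2 hA3 hA4 hs hB1 hB2 hB3 hB4 hA hB hIinf hIfin
  -- the bridge: the orbital of the norm is the fibre sum of the `L¹`-norms
  have hbridge := orbital_one_eq_tsum_integral_norm S₁ hFc hP₁ (S₁.orbitOf γ)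
  refine hbridge.symm.trans (hchain.trans ?_)
  simp [R₁, RTFData.trivialChars]

end Factor

end Summit.Ventures.HodgeRepro.Tier4.Line4

end
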